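import Summits.BirchSwinnertonDyer.BirchSwinnertonDyer.Theses.AdditiveKolyvaginRoad
import Summits.BirchSwinnertonDyer.BirchSwinnertonDyer.Theorems.AdditiveKolyvaginRoadManinFrameTransport
import HarnessLib

/-!
# Route `AdditiveKolyvaginRoad`, crux `ManinFrameResidueClass` (stmt-BirchSwinnertonDyer-20094):
# the residue decl on its DEGREE sub-locus, and the residue decl from ČNS-by-name plus the PROPER
# residue (glue proved) — `--supports` 20094

Cell `pub/bsd-wall` (D-0120, W-ALL lane 3, row 2), seat `bsd-wall-akr-p2` (prover, g3). THEOREMS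
ONLY (no definition, no named fact, no `sorry`); nothing is booked. This thin file imports the route
file (for the decl names) and the route-independent machinery
`AdditiveKolyvaginRoadManinFrameTransport.lean` (p521337).

WHAT IS PROVED, AND WHAT IS NOT. `ManinFrameResidueClass` (item 20094) is, on its class locus, the
`p`-part of Manin's conjecture for the `X₀(N)`-optimal curve (module docstring of the machinery
file; vetted open-problem). Print reaches into the residue only through the modular degree:
Česnavičius–Neururer–Saha 2024 Thm. 1.2, `val_p(c_φ) ≤ val_p(deg φ)` at `p ≥ 5` for every
surjection `X₀(N)_ℚ ↠ E'`, optimal or not (tree named fact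
`cesnaviciusNeururerSaha_padicVal_maninConstant_le_modularDegree`, here the hypothesis `hCNS` — a
PUBLISHED theorem taken BY NAME, exactly as items 20092/20093 take Edixhoven / Mazur / Abbes–Ullmo /
Česnavičius by name; it is NOT an antecedent of the decl as filed, so nothing here closes 20094).
* `frame_of_degreeClass` — **the conclusion of `ManinFrameResidueClass` on the DEGREE sub-locus**:
  `hCNS`, `PublishedInputsAdditiveKoly` (Modularity + Hoffstein–Luo), `p ≥ 5`, `Irr W p`,
  `r_an = 1`, and SOME globally minimal `W' ∼ W` with a parametrisation datum at level `N(W)` of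
  modular degree prime to `p` ⟹ the 9-conjunct frame. No `Addv`, no residue-locus hypothesis is
  needed (the degree reading is uniform in the reduction type).
* `maninFrameResidueClass_of_cns_of_proper` — **the decl BY NAME from `hCNS` and the PROPER
  residue**, i.e. the same decl with the extra hypothesis "EVERY parametrisation datum at level
  `N(W)` of EVERY globally minimal member of the class has modular degree divisible by `p`"; pure
  logic over `frame_of_degreeClass` (case split on the degree sub-locus). This is the glue of the
  resplit `ManinFrameResidueClass ⇐ (ČNS by name) ∧ (degree class, provable now = this file) ∧
  (proper residue)`, for the route's tenure planner; the proper residue — optimal Manin constant at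
  `p ∈ {5, 7}` of semistability defect `e ∈ {3, 4, 6}`, and at `p ≥ 11` potentially good ordinary
  of type II/III/IV, on classes all of whose `X₀(N)`-parametrisations have degree divisible by `p`
  — has no published proof (Edixhoven 1991 Thm. 3: `p > 7`, off these types; ČNS 2024 §1 lists the
  exception as standing; Cremona's tables give `c₀ = 1` instance-wise only).

References: [CesnaviciusNeururerSaha2023] JEMS 26 (2024) 573–637, Thm. 1.2, §1 (held
`paper:arxiv-1911.09446` p. 3); [EdixhovenManin1991] Thm. 3; [HoffsteinLuo1997] Theorem (§1);
[Darmon2004] Thm. 3.6; [JetchevSkinnerWan2017] §7.4.1.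
-/

set_option autoImplicit false
-- the Theorems directory repeats the summit name (sibling precedent `SignedBaseChangeAssembly.lean`)
set_option linter.dupNamespace false

noncomputable section

open scoped Classical

open WeierstrassCurve NumberField Literature.NumberTheory.EllipticCurves
  Literature.NumberTheory.EllipticCurves.ModularForms
  Literature.NumberTheory.EllipticCurves.Rank1Residual
  Literature.NumberTheory.DiophantineGeometry IsDedekindDomain Rat.HeightOneSpectrum
  Summit.BirchSwinnertonDyer.Rank1Residual Summit.BirchSwinnertonDyer.Rank1Residual.Additive
  Summit.BirchSwinnertonDyer.BirchSwinnertonDyer.Theses.AdditiveKolyvaginRoad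

namespace Summit.BirchSwinnertonDyer.BirchSwinnertonDyer.Theorems.ManinFrameResidueClass

/-- **The conclusion of `ManinFrameResidueClass` on the DEGREE sub-locus of the class.** Modulo
the ČNS fact `hCNS` (Česnavičius–Neururer–Saha 2024 Thm. 1.2 by name) and
`PublishedInputsAdditiveKoly` (only Modularity, conjunct 6, and Hoffstein–Luo, conjunct 7, are
used): for `W/ℚ` globally minimal, `p ≥ 5` with `E[p]` irreducible, `r_an = 1`, and some globally
minimal `W' ∼ W` with a parametrisation datum at level `N(W)` whose modular degree is prime to `p`,
the 9-conjunct Manin-good odd Heegner frame exists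
(`ManinFrameTransport.exists_oddHeegnerFrame_of_not_dvd_modularDegree`). Valid on the whole Manin
residue (no `Addv` / Kodaira hypothesis). [cite: CesnaviciusNeururerSaha2023, Thm. 1.2]
[cite: HoffsteinLuo1997, Theorem (§1)] [cite: Darmon2004, Thm. 3.6] -/
theorem frame_of_degreeClass
    (hCNS : cesnaviciusNeururerSaha_padicVal_maninConstant_le_modularDegree)
    (hPub : PublishedInputsAdditiveKoly)
    (W : WeierstrassCurve ℚ) [W.IsElliptic] [W.IsGloballyMinimal] (p : ℕ) [Fact p.Prime]
    [NeZero (W.conductorNorm ℤ)] (hp5 : 5 ≤ p) (hirr : Irr W p)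
    (hdeg : ∃ (W' : WeierstrassCurve ℚ) (_ : W'.IsElliptic) (_ : W'.IsGloballyMinimal)
      (D' : ModularParametrizationData W' (W.conductorNorm ℤ)),
      IsIsogenous W W' ∧ ¬ p ∣ D'.modularDegree)
    (hr : W.analyticRank = 1) :
    ∃ (K : Type) (_ : Field K) (_ : NumberField K)
      (Dt : ModularParametrizationData W (W.conductorNorm ℤ))
      (H : HeegnerDatum (W.conductorNorm ℤ) (NumberField.discr K)) (ι : K →+* ℂ)
      (P : (W.baseChange K).toAffine.Point)
      (Wd : WeierstrassCurve ℚ) (_ : Wd.IsElliptic) (_ : Wd.IsGloballyMinimal) (Cd : VariableChange ℚ),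
      IsImaginaryQuadratic K ∧ Odd (NumberField.discr K) ∧ ¬ (p : ℤ) ∣ NumberField.discr K ∧
        SatisfiesHeegnerHypothesis (W.conductorNorm ℤ) K ∧
        WeierstrassCurve.Affine.Point.map ι.toRatAlgHom P = heegnerPointComplex Dt H ∧
        ¬ (p : ℤ) ∣ Dt.c ∧ ¬ p ∣ Units.torsionOrder K ∧
        (W.quadraticTwist (NumberField.discr K : ℚ)).entireLFunction 1 ≠ 0 ∧
        Cd • W.quadraticTwist (NumberField.discr K : ℚ) = Wd := by
  obtain ⟨W', hW', hW'min, D', hiso, hdeg⟩ := hdeg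
  haveI := hW'
  haveI := hW'min
  exact ManinFrameTransport.exists_oddHeegnerFrame_of_not_dvd_modularDegree hPub.2.2.2.2.2.1
    hPub.2.2.2.2.2.2.1 hCNS W p hr hp5 hirr hiso D' hdeg

/-- **`ManinFrameResidueClass` BY NAME from ČNS-by-name and the PROPER residue** (the resplit
glue, proved): given the ČNS fact `hCNS` and the decl's own statement strengthened by the extra
hypothesis "every parametrisation datum at level `N(W)` of every globally minimal member `W' ∼ W`
has modular degree divisible by `p`" (the proper residue, `hProper`), the decl follows — on the
degree sub-locus by `frame_of_degreeClass`, elsewhere by `hProper`. Pure logic. Documents the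
content of item 20094: modulo a published theorem taken by name, what remains is the optimal
Manin constant on residue classes all of whose `X₀(N)`-parametrisations have degree divisible by
`p` (no published proof). [cite: CesnaviciusNeururerSaha2023, Thm. 1.2 and §1]
[cite: EdixhovenManin1991, Thm. 3] -/
theorem maninFrameResidueClass_of_cns_of_proper
    (hCNS : cesnaviciusNeururerSaha_padicVal_maninConstant_le_modularDegree)
    (hProper : PublishedInputsAdditiveKoly → ∀ (W : WeierstrassCurve ℚ) [W.IsElliptic]
      [W.IsGloballyMinimal] (p : ℕ) [Fact p.Prime] [NeZero (W.conductorNorm ℤ)], 5 ≤ p →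
      Addv W p → Irr W p →
      ((p < 11 ∨ ∃ (W' : WeierstrassCurve ℚ) (_ : W'.IsElliptic) (_ : W'.IsGloballyMinimal),
          IsIsogenous W W' ∧ TypeGOrd W' p ∧ padicValInt p W'.minimalDiscriminantInt ≤ 4) ∧
        (∃ (W' : WeierstrassCurve ℚ) (_ : W'.IsElliptic) (_ : W'.IsGloballyMinimal),
          IsIsogenous W W' ∧ ∀ (v : HeightOneSpectrum ℤ) (n : ℕ), natGenerator v = p →
            W'.kodairaSymbolAt v ≠ KodairaSymbol.Istar n)) →
      (∀ (W' : WeierstrassCurve ℚ) [W'.IsElliptic] [W'.IsGloballyMinimal]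
          (D' : ModularParametrizationData W' (W.conductorNorm ℤ)),
          IsIsogenous W W' → p ∣ D'.modularDegree) →
      W.analyticRank = 1 →
      ∃ (K : Type) (_ : Field K) (_ : NumberField K)
        (Dt : ModularParametrizationData W (W.conductorNorm ℤ))
        (H : HeegnerDatum (W.conductorNorm ℤ) (NumberField.discr K)) (ι : K →+* ℂ)
        (P : (W.baseChange K).toAffine.Point)
        (Wd : WeierstrassCurve ℚ) (_ : Wd.IsElliptic) (_ : Wd.IsGloballyMinimal)
        (Cd : VariableChange ℚ),
        IsImaginaryQuadratic K ∧ Odd (NumberField.discr K) ∧ ¬ (p : ℤ) ∣ NumberField.discr K ∧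
          SatisfiesHeegnerHypothesis (W.conductorNorm ℤ) K ∧
          WeierstrassCurve.Affine.Point.map ι.toRatAlgHom P = heegnerPointComplex Dt H ∧
          ¬ (p : ℤ) ∣ Dt.c ∧ ¬ p ∣ Units.torsionOrder K ∧
          (W.quadraticTwist (NumberField.discr K : ℚ)).entireLFunction 1 ≠ 0 ∧
          Cd • W.quadraticTwist (NumberField.discr K : ℚ) = Wd) :
    ManinFrameResidueClass := by
  intro hPub W _ _ p _ _ hp5 hadd hirr hres hr
  by_cases hdeg : ∃ (W' : WeierstrassCurve ℚ) (_ : W'.IsElliptic) (_ : W'.IsGloballyMinimal)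
      (D' : ModularParametrizationData W' (W.conductorNorm ℤ)),
      IsIsogenous W W' ∧ ¬ p ∣ D'.modularDegree
  · exact frame_of_degreeClass hCNS hPub W p hp5 hirr hdeg hr
  · push Not at hdeg
    exact hProper hPub W p hp5 hadd hirr hres (fun W' hE hM D' hiso ↦ hdeg W' hE hM D' hiso) hr

/-- **Conversely, the decl forces Manin's `p`-part at the optimal curve of every residue class it
covers**: if `ManinFrameResidueClass` holds then, granted `PublishedInputsAdditiveKoly`, for every
residue frame `(W, p)` of the decl (`p ≥ 5`, `Addv`, `Irr`, residue locus, `r_an = 1`) and every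
LATTICE-OPTIMAL datum `D₀` (`Λ_{W₀} = c₀ Λ_f`, the strong parametrisation) of every globally minimal
`W₀ ∼ W` at level `N(W)`: `p ∤ c₀` (`ManinFrameTransport.not_dvd_optimal_c_of_exists_not_dvd` on
the sixth conjunct of the frame). So item 20094 is not merely implied by, but EQUIVALENT on its
locus to, the `p`-part of Manin's conjecture `c₀ = ±1` for these optimal curves — the certificate
behind the open-problem label. [cite: EdixhovenManin1991, §1 and Prop. 2]
[cite: AgasheRibetStein2006, Thm. 2.6 and §2] -/
theorem not_dvd_optimal_c_of_maninFrameResidueClass (h : ManinFrameResidueClass)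
    (hPub : PublishedInputsAdditiveKoly)
    (W : WeierstrassCurve ℚ) [W.IsElliptic] [W.IsGloballyMinimal] (p : ℕ) [hp : Fact p.Prime]
    [NeZero (W.conductorNorm ℤ)] (hp5 : 5 ≤ p) (hadd : Addv W p) (hirr : Irr W p)
    (hres : (p < 11 ∨ ∃ (W' : WeierstrassCurve ℚ) (_ : W'.IsElliptic) (_ : W'.IsGloballyMinimal),
        IsIsogenous W W' ∧ TypeGOrd W' p ∧ padicValInt p W'.minimalDiscriminantInt ≤ 4) ∧
      (∃ (W' : WeierstrassCurve ℚ) (_ : W'.IsElliptic) (_ : W'.IsGloballyMinimal),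
        IsIsogenous W W' ∧ ∀ (v : HeightOneSpectrum ℤ) (n : ℕ), natGenerator v = p →
          W'.kodairaSymbolAt v ≠ KodairaSymbol.Istar n))
    (hr : W.analyticRank = 1)
    {W₀ : WeierstrassCurve ℚ} [W₀.IsElliptic] [W₀.IsGloballyMinimal] (hiso : IsIsogenous W W₀)
    (D₀ : ModularParametrizationData W₀ (W.conductorNorm ℤ))
    (hopt : ∀ z ∈ D₀.L.lattice, ∃ w ∈ periodLattice D₀.f, z = D₀.c * w) :
    ¬ (p : ℤ) ∣ D₀.c := by
  obtain ⟨K, _, _, Dt, H, ι, P, Wd, _, _, Cd, -, -, -, -, -, hc, -⟩ :=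
    h hPub W p hp5 hadd hirr hres hr
  exact ManinFrameTransport.not_dvd_optimal_c_of_exists_not_dvd W hp.out hirr ⟨Dt, hc⟩ hiso D₀ hopt

/-! ### §4 (appended, `bsd-wall-akr-p2` g5, route rev 11): item 20094 from the rev-10 top-level items BY NAME

Since rev 10 the residue is carried by two top-level route items bound by `closes` directly:
`CesnaviciusNeururerSahaManinDegree` (stmt-20481, the ČNS theorem taken by name) and the crux
`ManinFrameResidueProper` (stmt-20483, = the hypothesis `hProper` above, verbatim); the degree-class
item `ManinFrameResidueDegreeClass` (stmt-20482) is a theorem (`frame_of_degreeClass`). The two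
implications below are the by-name form of `maninFrameResidueClass_of_cns_of_proper` and of the
`hRes` step of `closes`: they document that the former crux `ManinFrameResidueClass` (20094, now a
support item) has no content beyond 20481 and 20483 — pure logic, nothing new is claimed. -/

/-- **`ManinFrameResidueClass` (item 20094) from the route items `CesnaviciusNeururerSahaManinDegree`
(20481, Česnavičius–Neururer–Saha 2024 Thm. 1.2 by name) and `ManinFrameResidueProper` (20483, the
proper Manin residue), BY NAME.** The crux 20483 is literally the hypothesis `hProper` of
`maninFrameResidueClass_of_cns_of_proper`, and 20481 unfolds to the ČNS named fact; so this is that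
theorem re-typed in the route's item vocabulary. [cite: CesnaviciusNeururerSaha2023, Thm. 1.2 and §1] -/
theorem maninFrameResidueClass_of_cns_of_residueProper
    (hC : CesnaviciusNeururerSahaManinDegree) (hR : ManinFrameResidueProper) :
    ManinFrameResidueClass :=
  maninFrameResidueClass_of_cns_of_proper hC hR

/-- **The same with the degree-class item displayed** (the `hRes` step of the route's deciding
theorem `closes`, as a citable lemma): `CesnaviciusNeururerSahaManinDegree` (20481) →
`ManinFrameResidueDegreeClass` (20482, proved) → `ManinFrameResidueProper` (20483) →
`ManinFrameResidueClass` (20094) — case split on the degree sub-locus «some minimal `W' ∼ W` has a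
level-`N(W)` parametrisation datum of degree prime to `p`». Pure logic.
[cite: CesnaviciusNeururerSaha2023, Thm. 1.2 and §1] -/
theorem maninFrameResidueClass_of_items
    (hC : CesnaviciusNeururerSahaManinDegree) (hD : ManinFrameResidueDegreeClass)
    (hR : ManinFrameResidueProper) :
    ManinFrameResidueClass := by
  intro hPub W _ _ p _ _ hp5 hadd hirr hres hr
  by_cases hdeg : ∃ (W' : WeierstrassCurve ℚ) (_ : W'.IsElliptic) (_ : W'.IsGloballyMinimal)
      (D' : ModularParametrizationData W' (W.conductorNorm ℤ)),
      IsIsogenous W W' ∧ ¬ p ∣ D'.modularDegree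
  · exact hD hC hPub W p hp5 hadd hirr hres hdeg hr
  · push Not at hdeg
    exact hR hPub W p hp5 hadd hirr hres (fun W' hE hM D' hiso ↦ hdeg W' hE hM D' hiso) hr

end Summit.BirchSwinnertonDyer.BirchSwinnertonDyer.Theorems.ManinFrameResidueClass

end
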